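import Literature.Claims.NS.Rockwell2025
import Literature.Analysis.FluidPDE.SerrinPotentialFlowExample
import HarnessLib

/-!
# C88 `Rockwell2025` — kernel countermodel to the IMPLICIT flow-map step (53) p.14 (`Step_flow`)

`Literature.Claims.NS.Rockwell2025.Step_flow` asserts: for every `ν > 0`, `K > 5`, every datum of the decay
class (77) and EVERY classical solution `(u, p)` of Navier–Stokes on `[0,T)` issued from it, a flow map
`Φ` (`Φ₀ = id`, `∂ₜΦ_t(x) = u(t, Φ_t(x))` on `[0,T)`, `IsFlowMap T u Φ`) exists. The antecedent carries no bound
on `u(t, ·)` for `t > 0`, and the typed class contains Serrin's potential flows (tree file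
`Literature/Analysis/FluidPDE/SerrinPotentialFlowExample.lean`): with the harmonic cubic `θ(x) = x₀x₁x₂` and
the amplitude `a(t) = t`, the pair `u(t,x) = t ∇θ(x) = t (x₁x₂, x₀x₂, x₀x₁)`, `p = −θ − t²|∇θ|²/2` is a classical
solution on `ℝ × ℝ³` for every `ν` (`isClassicalNSSolutionOn_serrinFlow`), with `u(0) = 0` — and `0` is a datum
of class (77) for every `K`. Along the invariant diagonal `x₀ = x₁ = x₂` the trajectory equation is
`c' = t c²`, `c(0) = 1`, whose solution `c(t) = (1 − t²/2)⁻¹` leaves every ball before `t* = √2 < T := 2`;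
by uniqueness (Mathlib `ODE_solution_unique_of_mem_Icc_right`, the field being `C¹` hence Lipschitz on balls)
any flow line from `(1,1,1)` coincides with it on `[0, τ]` for every `τ < √2`, contradicting the continuity
on `[0, 2)` that `IsFlowMap 2 u Φ` forces. Hence `¬ Step_flow`.

Kit by ns-claims-typist-2 g6 (D-0090 cell, D-0026 debt hygiene: DEBT-TRIAGE row `Rockwell2025.Step_flow`
NOT-AS-TYPED → countermodel), for a prover-role filer to file UNCHANGED; nothing here asserts anything
about Navier–Stokes regularity. Token/class of record of row C88 are untouched.
WHAT THIS IS NOT: not a claim about NS regularity or blow-up; not a claim about any author beyond the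
typed locator.
-/

set_option linter.dupNamespace false

noncomputable section

open Set Function Filter Metric
open scoped Topology NNReal ContDiff Laplacian InnerProductSpace

namespace Summit.NavierStokesRegularity.NavierStokesRegularity.Theorems.Rockwell2025Flow

open Literature.Claims.NS.Rockwell2025 Literature.Analysis.FluidPDE

/-- `ℝ³`. -/
abbrev R3 := EuclideanSpace ℝ (Fin 3)

/-- The coordinate functionals `x ↦ xᵢ`. -/
abbrev P (i : Fin 3) : R3 →L[ℝ] ℝ := EuclideanSpace.proj i

/-- The standard basis vectors `eᵢ`. -/
abbrev e (i : Fin 3) : R3 := EuclideanSpace.single i 1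

/-- kit lemma (plumbing) [folklore] -/
@[simp] theorem P_apply (i : Fin 3) (x : R3) : P i x = x i := rfl

/-! ## The harmonic cubic `θ = x₀x₁x₂` and its gradient field -/

/-- `θ(x) = x₀ x₁ x₂`. -/
def theta (x : R3) : ℝ := x 0 * x 1 * x 2

/-- `W(x) = ∇θ(x) = (x₁x₂, x₀x₂, x₀x₁)`. -/
def W (x : R3) : R3 := (x 1 * x 2) • e 0 + (x 0 * x 2) • e 1 + (x 0 * x 1) • e 2

/-- `Dθ(x)` as a continuous linear functional. -/
def Dtheta (x : R3) : R3 →L[ℝ] ℝ := (x 1 * x 2) • P 0 + (x 0 * x 2) • P 1 + (x 0 * x 1) • P 2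

/-- `DW(x)`. -/
def DW (x : R3) : R3 →L[ℝ] R3 :=
  (P 1 x • P 2 + P 2 x • P 1).smulRight (e 0) + (P 0 x • P 2 + P 2 x • P 0).smulRight (e 1) +
    (P 0 x • P 1 + P 1 x • P 0).smulRight (e 2)

/-- kit lemma (plumbing) [folklore] -/
theorem theta_eq : theta = fun y : R3 => P 0 y * P 1 y * P 2 y := rfl

/-- kit lemma (plumbing) [folklore] -/
theorem W_eq : W = fun y : R3 => (P 1 y * P 2 y) • e 0 + (P 0 y * P 2 y) • e 1 + (P 0 y * P 1 y) • e 2 := rfl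

/-- kit lemma (plumbing) [folklore] -/
theorem hasFDerivAt_theta (x : R3) : HasFDerivAt theta (Dtheta x) x := by
  have h := (((P 0).hasFDerivAt (x := x)).mul ((P 1).hasFDerivAt (x := x))).mul
    ((P 2).hasFDerivAt (x := x))
  rw [theta_eq]
  refine h.congr_fderiv ?_
  ext v
  simp [Dtheta, Pi.mul_apply]
  ring

/-- kit lemma (plumbing) [folklore] -/
theorem fderiv_theta (x : R3) : fderiv ℝ theta x = Dtheta x := (hasFDerivAt_theta x).fderiv

/-- kit lemma (plumbing) [folklore] -/
theorem contDiff_theta : ContDiff ℝ ∞ theta := by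
  rw [theta_eq]
  exact (((P 0).contDiff).mul (P 1).contDiff).mul (P 2).contDiff

/-- kit lemma (plumbing) [folklore] -/
theorem hasFDerivAt_W (x : R3) : HasFDerivAt W (DW x) x := by
  have h0 := (P 0).hasFDerivAt (x := x)
  have h1 := (P 1).hasFDerivAt (x := x)
  have h2 := (P 2).hasFDerivAt (x := x)
  rw [W_eq]
  exact (((h1.mul h2).smul_const (e 0)).add ((h0.mul h2).smul_const (e 1))).add
    ((h0.mul h1).smul_const (e 2))

/-- kit lemma (plumbing) [folklore] -/
theorem contDiff_W : ContDiff ℝ ∞ W := by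
  rw [W_eq]
  exact ((((P 1).contDiff.mul (P 2).contDiff).smul contDiff_const).add
    (((P 0).contDiff.mul (P 2).contDiff).smul contDiff_const)).add
    (((P 0).contDiff.mul (P 1).contDiff).smul contDiff_const)

/-- Coordinates of a gradient: `(∇V)ᵢ = DV eᵢ`. [folklore] -/
private theorem gradient_apply_eq_fderiv_single (V : R3 → ℝ) (x : R3) (i : Fin 3) :
    gradient V x i = fderiv ℝ V x (e i) := by
  have h1 : gradient V x i = ⟪gradient V x, EuclideanSpace.single i (1 : ℝ)⟫_ℝ := by
    rw [EuclideanSpace.inner_single_right]; simp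
  rw [h1, gradient, InnerProductSpace.toDual_symm_apply]

/-- `∇θ = W`. -/
theorem gradient_theta (x : R3) : gradient theta x = W x := by
  ext i
  rw [gradient_apply_eq_fderiv_single, fderiv_theta]
  fin_cases i <;> simp [Dtheta, W]

/-- The divergence on `ℝ³` in coordinates. [folklore] -/
private theorem divergence_eq_sum_three (v : R3 → R3) (x : R3) :
    VectorCalculus.divergence v x =
      fderiv ℝ v x (e 0) 0 + fderiv ℝ v x (e 1) 1 + fderiv ℝ v x (e 2) 2 := by
  rw [divergence_eq_sum_inner_fderiv (EuclideanSpace.basisFun (Fin 3) ℝ)]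
  simp [Fin.sum_univ_three, EuclideanSpace.inner_single_left]

/-- `θ` is harmonic: `Δθ = div ∇θ = ∂₀(x₁x₂) + ∂₁(x₀x₂) + ∂₂(x₀x₁) = 0`. -/
theorem laplacian_theta (x : R3) : Δ theta x = 0 := by
  rw [← divergence_gradient (contDiff_theta.of_le (by norm_cast)) x]
  have hg : gradient theta = W := funext gradient_theta
  rw [hg, divergence_eq_sum_three, (hasFDerivAt_W x).fderiv]
  simp [DW]

/-! ## The classical solution `u = t ∇θ` from the datum `0` -/

/-- The amplitude `a(t) = t`. -/
def amp : ℝ → ℝ := fun t => t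

/-- `u(t, x) = t ∇θ(x)` (Serrin's potential flow). -/
def uW : ℝ → R3 → R3 := serrinFlow theta amp

/-- Its Bernoulli pressure. -/
def pW : ℝ → R3 → ℝ := serrinPressure theta amp (deriv amp)

/-- kit lemma (plumbing) [folklore] -/
theorem uW_apply (t : ℝ) (y : R3) : uW t y = t • W y := by
  show amp t • gradient theta y = t • W y
  rw [gradient_theta]; rfl

/-- kit lemma (plumbing) [folklore] -/
theorem uW_zero : uW 0 = 0 := by
  funext y; rw [uW_apply, zero_smul]; rfl

/-- `(uW, pW)` is a classical Navier–Stokes solution on `[0, T)` for every `ν` (zero force). -/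
theorem isClassicalNSSolutionOn_uW (ν : ℝ) (T : ℝ) :
    IsClassicalNSSolutionOn (Ico 0 T) ν 0 uW pW :=
  (isClassicalNSSolutionOn_serrinFlow contDiff_theta laplacian_theta (a := amp) contDiff_id ν).mono
    (subset_univ _) (uniqueDiffOn_Ico 0 T)

/-- `0` is a datum of the decay class (77) for every `K`. -/
theorem isDecayDatum_zero (K : ℝ) : IsDecayDatum K (0 : R3 → R3) := by
  refine ⟨contDiff_const, fun x => ?_, fun n => ⟨0, fun x => ?_⟩⟩
  · have h : fderiv ℝ (0 : R3 → R3) x = 0 := by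
      rw [show (0 : R3 → R3) = fun _ => (0 : R3) from rfl]
      exact (hasFDerivAt_const (0 : R3) x).fderiv
    simp [NSWave0.divergence, h]
  · have h : iteratedFDeriv ℝ n (0 : R3 → R3) x = 0 := by
      rw [show (0 : R3 → R3) = fun _ => (0 : R3) from rfl]
      simp
    simp [h]

/-! ## The exploding trajectory along the diagonal -/

/-- The diagonal vector `d = (1,1,1)`. -/
def diag : R3 := e 0 + e 1 + e 2

/-- kit lemma (plumbing) [folklore] -/
theorem W_smul_diag (c : ℝ) : W (c • diag) = c ^ 2 • diag := by
  ext i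
  fin_cases i <;> simp [W, diag] <;> ring

/-- kit lemma (plumbing) [folklore] -/
theorem diag_ne_zero : diag ≠ 0 := by
  intro h
  have := congrArg (fun v : R3 => v 0) h
  simp [diag] at this

/-- kit lemma (plumbing) [folklore] -/
theorem norm_diag_pos : 0 < ‖diag‖ := norm_pos_iff.2 diag_ne_zero

/-- `c(t) = (1 − t²/2)⁻¹`, the solution of `c' = t c²`, `c(0) = 1`, on `[0, √2)`. -/
def cfun (t : ℝ) : ℝ := (1 - t ^ 2 / 2)⁻¹

/-- The explicit trajectory `y(t) = c(t) d`. -/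
def ysol (t : ℝ) : R3 := cfun t • diag

/-- kit lemma (plumbing) [folklore] -/
theorem hasDerivAt_cfun {t : ℝ} (ht : 1 - t ^ 2 / 2 ≠ 0) : HasDerivAt cfun (t * cfun t ^ 2) t := by
  have h1 : HasDerivAt (fun s : ℝ => 1 - s ^ 2 / 2) (-t) t := by
    have h := (((hasDerivAt_id t).mul (hasDerivAt_id t)).div_const 2).const_sub 1
    have e1 : (fun s : ℝ => 1 - s ^ 2 / 2) = fun y => 1 - id y * id y / 2 := by
      funext s; simp only [id]; ring
    have e2 : (-t : ℝ) = -((1 * id t + id t * 1) / 2) := by simp only [id]; ring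
    rw [e1, e2]; exact h
  have h2 := h1.inv ht
  have e3 : -(-t) / (1 - t ^ 2 / 2) ^ 2 = t * cfun t ^ 2 := by
    rw [cfun, inv_pow]; field_simp
  rw [← e3]; exact h2

/-- kit lemma (plumbing) [folklore] -/
theorem hasDerivAt_ysol {t : ℝ} (ht : 1 - t ^ 2 / 2 ≠ 0) : HasDerivAt ysol (t • W (ysol t)) t := by
  have h := (hasDerivAt_cfun ht).smul_const diag
  have hval : (t * cfun t ^ 2) • diag = t • W (ysol t) := by
    rw [ysol, W_smul_diag, smul_smul]
  rw [← hval]; exact h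

/-- kit lemma (plumbing) [folklore] -/
theorem ysol_zero : ysol 0 = diag := by simp [ysol, cfun]

/-- `DW` is bounded on every ball (it is continuous). -/
theorem exists_fderiv_W_bound (R : ℝ) :
    ∃ C : ℝ≥0, ∀ y ∈ closedBall (0 : R3) R, ‖fderiv ℝ W y‖ ≤ C := by
  have hcont : Continuous (fderiv ℝ W) := contDiff_W.continuous_fderiv (by simp)
  obtain ⟨C, hC⟩ := (isCompact_closedBall (0 : R3) R).exists_bound_of_continuousOn hcont.continuousOn
  exact ⟨⟨max C 0, le_max_right _ _⟩, fun y hy => (hC y hy).trans (le_max_left C 0)⟩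

/-- The field `y ↦ t • W y`, `|t| ≤ 2`, is `2C`-Lipschitz on a ball where `‖DW‖ ≤ C` (mean value
inequality on the convex ball). -/
theorem lipschitzOnWith_smul_W {R : ℝ} {C : ℝ≥0} (hC : ∀ y ∈ closedBall (0 : R3) R, ‖fderiv ℝ W y‖ ≤ C)
    {t : ℝ} (ht : |t| ≤ 2) :
    LipschitzOnWith (2 * C) (fun y => t • W y) (closedBall (0 : R3) R) := by
  have hd : ∀ y : R3, HasFDerivAt (fun z => t • W z) (t • DW y) y := fun y =>
    (hasFDerivAt_W y).const_smul t
  refine (convex_closedBall (0 : R3) R).lipschitzOnWith_of_nnnorm_fderiv_le (𝕜 := ℝ)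
    (fun y _ => (hd y).differentiableAt) (fun y hy => ?_)
  rw [← NNReal.coe_le_coe, coe_nnnorm, NNReal.coe_mul, (hd y).fderiv, norm_smul, Real.norm_eq_abs]
  have h1 : ‖DW y‖ ≤ C := by
    have := hC y hy
    rwa [(hasFDerivAt_W y).fderiv] at this
  have h2 : ((2 : ℝ≥0) : ℝ) = 2 := rfl
  rw [h2]
  exact mul_le_mul ht h1 (norm_nonneg _) (by norm_num)

/-! ## The refutation -/

/-- **`Step_flow` is false**: the classical solution `u = t∇(x₀x₁x₂)` from the datum `0` on `[0, 2)` has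
no flow map — the flow line from `(1,1,1)` is `(1 − t²/2)⁻¹ (1,1,1)` and explodes at `t = √2 < 2`. -/
theorem not_Step_flow : ¬ Step_flow := by
  intro h
  obtain ⟨Φ, hΦ0, hΦ⟩ := h 1 one_pos 6 (by norm_num) 0 (isDecayDatum_zero 6) 2 uW pW
    (isClassicalNSSolutionOn_uW 1 2) uW_zero
  -- the flow line from the diagonal point
  set γ : ℝ → R3 := fun s => Φ s diag with hγ
  have hγ0 : γ 0 = diag := hΦ0 diag
  have hγder : ∀ t ∈ Ico (0 : ℝ) 2, HasDerivWithinAt γ (t • W (γ t)) (Ico 0 2) t := by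
    intro t ht
    have := hΦ diag t ht
    rw [uW_apply] at this
    exact this
  have hγcont : ContinuousOn γ (Ico 0 2) := fun t ht => (hγder t ht).continuousWithinAt
  -- `γ` is bounded on `[0, 3/2]`
  have hsub : Icc (0 : ℝ) (3 / 2) ⊆ Ico 0 2 := fun t ht => ⟨ht.1, by linarith [ht.2]⟩
  obtain ⟨B, hB⟩ := (isCompact_Icc : IsCompact (Icc (0 : ℝ) (3 / 2))).exists_bound_of_continuousOn
    (hγcont.mono hsub)
  have hBpos : 0 < B := by
    have := hB 0 ⟨le_rfl, by norm_num⟩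
    rw [hγ0] at this
    exact norm_diag_pos.trans_le this
  -- uniqueness: `γ = ysol` on `[0, τ]` whenever `τ² < 2`
  have huniq : ∀ τ : ℝ, 0 ≤ τ → τ ^ 2 < 2 → γ τ = ysol τ := by
    intro τ hτ0 hτ
    have hτ32 : τ < 3 / 2 := by nlinarith
    have hden : ∀ t ∈ Icc 0 τ, 1 - t ^ 2 / 2 ≠ 0 := by
      intro t ht
      have : t ^ 2 ≤ τ ^ 2 := pow_le_pow_left₀ ht.1 ht.2 2
      intro h0; linarith
    have hycont : ContinuousOn ysol (Icc 0 τ) := fun t ht =>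
      (hasDerivAt_ysol (hden t ht)).continuousAt.continuousWithinAt
    obtain ⟨By, hBy⟩ := (isCompact_Icc : IsCompact (Icc (0 : ℝ) τ)).exists_bound_of_continuousOn hycont
    set R : ℝ := max B By with hR
    obtain ⟨C, hC⟩ := exists_fderiv_W_bound R
    -- the field `y ↦ t • W y`, `t ∈ [0, τ)`, is `2C`-Lipschitz on the ball
    have hlip : ∀ t ∈ Ico 0 τ, LipschitzOnWith (2 * C) (fun y => t • W y) (closedBall (0 : R3) R) :=
      fun t ht => lipschitzOnWith_smul_W hC (by rw [abs_of_nonneg ht.1]; linarith [ht.2])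
    have hIcc : Icc 0 τ ⊆ Ico (0 : ℝ) 2 := fun t ht => ⟨ht.1, by linarith [ht.2]⟩
    have hEq : EqOn γ ysol (Icc 0 τ) := by
      refine ODE_solution_unique_of_mem_Icc_right (v := fun t y => t • W y)
        (s := fun _ => closedBall (0 : R3) R) (K := 2 * C) hlip
        (hγcont.mono hIcc) (fun t ht => ?_) (fun t ht => ?_) hycont (fun t ht => ?_) (fun t ht => ?_)
        (by rw [hγ0, ysol_zero])
      · -- right derivative of `γ`
        have ht2 : t ∈ Ico (0 : ℝ) 2 := ⟨ht.1, by linarith [ht.2]⟩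
        refine (hγder t ht2).mono_of_mem_nhdsWithin ?_
        exact mem_of_superset (Ico_mem_nhdsGE ht2.2) (Ico_subset_Ico_left ht.1)
      · -- `γ` stays in the ball
        rw [mem_closedBall_zero_iff]
        exact (hB t ⟨ht.1, by linarith [ht.2]⟩).trans (le_max_left _ _)
      · exact (hasDerivAt_ysol (hden t ⟨ht.1, ht.2.le⟩)).hasDerivWithinAt
      · rw [mem_closedBall_zero_iff]
        exact (hBy t ⟨ht.1, ht.2.le⟩).trans (le_max_right _ _)
    exact hEq ⟨hτ0, le_rfl⟩
  -- choose `τ` with `c(τ) ‖d‖ ≥ B + 1`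
  set ε : ℝ := min (1 / 2) (‖diag‖ / (B + 1)) with hε
  have hεpos : 0 < ε := lt_min (by norm_num) (div_pos norm_diag_pos (by linarith))
  have hεhalf : ε ≤ 1 / 2 := min_le_left _ _
  have hεle : ε ≤ ‖diag‖ / (B + 1) := min_le_right _ _
  set τ : ℝ := Real.sqrt (2 * (1 - ε)) with hτ
  have h2pos : 0 ≤ 2 * (1 - ε) := by linarith
  have hτsq : τ ^ 2 = 2 * (1 - ε) := by rw [hτ, Real.sq_sqrt h2pos]
  have hτ0 : 0 ≤ τ := Real.sqrt_nonneg _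
  have hτlt : τ ^ 2 < 2 := by rw [hτsq]; linarith
  have hτ32 : τ ≤ 3 / 2 := by nlinarith
  have hcτ : cfun τ = ε⁻¹ := by
    rw [cfun, hτsq]; congr 1; ring
  have hnorm : ‖γ τ‖ = ε⁻¹ * ‖diag‖ := by
    rw [huniq τ hτ0 hτlt, ysol, norm_smul, hcτ, Real.norm_eq_abs, abs_of_pos (inv_pos.2 hεpos)]
  have hbig : B + 1 ≤ ‖γ τ‖ := by
    rw [hnorm]
    have h1 : ε * (B + 1) ≤ ‖diag‖ := by
      have := hεle
      rwa [le_div_iff₀ (by linarith)] at this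
    calc B + 1 = ε⁻¹ * (ε * (B + 1)) := by field_simp
      _ ≤ ε⁻¹ * ‖diag‖ := by gcongr
  have hsmall : ‖γ τ‖ ≤ B := hB τ ⟨hτ0, hτ32⟩
  linarith

end Summit.NavierStokesRegularity.NavierStokesRegularity.Theorems.Rockwell2025Flow

end
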